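import Mathlib
import HarnessLib
import Summits.HubbardSuperconductivity.HubbardSuperconductivity.Theorems.KLProgrammeKLRegimeSplitModelCongr
import Summits.HubbardSuperconductivity.HubbardSuperconductivity.Theorems.KLProgrammeKLRegimeCountertermGridIdentity

/-!
# Route `KLProgramme`, crux K3 — Δ23: today's INTERPOLANT pieces and the FUNCTION pieces agree — as `TrigPolyC4v` views and at every lattice momentum

Cell gate-hubbard-kl, seat p2 (g6); continues `…SplitFrameFn` / `…FrameFnLemmas` / `…ModelCongr`; uses k3c3-p3's grid identities
(`…CountertermGridIdentity`).  For a `TrigPolyC4v` frame `K` read as the function `K.eval`: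

* `toTrigPoly_klTwoLegPolyFn_eval : toTrigPoly L (klTwoLegPolyFn … K.eval n) = klTwoLegPolyG … K n` and the same for the normal form
  (`toTrigPoly_klFrameProjFn_eval`) — today's G-objects ARE the model's views of the function objects (same `symInterp` of the same data);
* at every lattice momentum the function objects take the values of today's interpolants:
  `klTwoLegPolyFn … K.eval n (p_k) = (klTwoLegPolyG … K n).eval (p_k)`, `klFrameProjFn μ K.eval (p_k) = (klFrameProjG L μ K).eval (p_k)`,
  hence for the PIECES `klTwoLegPieceFn … K.eval n (p_k) = (klTwoLegPieceG … K n).eval (p_k)` and for child 2's counter-image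
  `(K.eval − Σ_{i≤n} ℓ_i^{Fn}) (p_k) = (P^G K ⊖ D_n^G K)(p_k) + (K − P^G K)(p_k)`-type transfers: every VALUE-LEVEL statement of the
  status quo at lattice momenta (the model's reads, the flat-tube grid identities) holds for the function pieces verbatim.

So under (R-I-min) the MODEL sees exactly the frames it sees today; only the derivative clauses moved to the functions.  Proofs only.
-/

noncomputable section

namespace Summit.HubbardSuperconductivity.HubbardSuperconductivity.Theorems.KLRegimeSplit

set_option linter.dupNamespace false -- summit = problem name (single-conjunct summit), D-0017

open Real Finset Literature.MathematicalPhysics.QuantumLattice Literature.Probability.LatticeModels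
open Literature.MathematicalPhysics.QuantumLattice.FermiRG

section Views

variable (L M : ℕ) [NeZero L] [NeZero M]

/-- **The model's view of the function `D_n` of a `TrigPolyC4v` frame IS today's `D_n^G`.** -/
theorem toTrigPoly_klTwoLegPolyFn_eval (β U μ : ℝ) (K : TrigPolyC4v) (n : ℕ) :
    toTrigPoly L (klTwoLegPolyFn L M β U μ K.eval n) = klTwoLegPolyG L M β U μ K n := by
  rw [klTwoLegPolyFn_eval, toTrigPoly_klFrameExtFn, klTwoLegPolyG]

omit [NeZero M] in
/-- **The model's view of the function normal form `P(K.eval)` IS today's `P^G(K)`.** -/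
theorem toTrigPoly_klFrameProjFn_eval (μ : ℝ) (K : TrigPolyC4v) :
    toTrigPoly L (klFrameProjFn μ K.eval) = klFrameProjG L μ K := by
  rw [klFrameProjFn, toTrigPoly_klFrameExtFn, klFrameProjG]
  rfl

/-! ## Values at lattice momenta -/

/-- At every lattice momentum the function `D_n(K.eval)` equals today's interpolant `D_n^G(K)`. -/
theorem klTwoLegPolyFn_eval_latticeMomentum (β U μ : ℝ) (K : TrigPolyC4v) (n : ℕ) (k : TorusSite 2 L) :
    klTwoLegPolyFn L M β U μ K.eval n (latticeMomentum L k) = (klTwoLegPolyG L M β U μ K n).eval (latticeMomentum L k) := by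
  rw [klTwoLegPolyFn_eval, klFrameExtFn_latticeMomentum, eval_klTwoLegPolyG_latticeMomentum]

omit [NeZero M] in
/-- At every lattice momentum the function normal form equals today's `P^G(K)`. -/
theorem klFrameProjFn_eval_latticeMomentum (μ : ℝ) (K : TrigPolyC4v) (k : TorusSite 2 L) :
    klFrameProjFn μ K.eval (latticeMomentum L k) = (klFrameProjG L μ K).eval (latticeMomentum L k) := by
  rw [klFrameProjFn, klFermiPointFn_eval, klFrameExtFn_latticeMomentum, eval_klFrameProjG_latticeMomentum]

/-- **At every lattice momentum the function PIECE `ℓ_n(K.eval)` equals today's interpolant piece `ℓ_n^G(K)`.** -/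
theorem klTwoLegPieceFn_eval_latticeMomentum (β U μ : ℝ) (K : TrigPolyC4v) (n : ℕ) (k : TorusSite 2 L) :
    klTwoLegPieceFn L M β U μ K.eval n (latticeMomentum L k) = (klTwoLegPieceG L M β U μ K n).eval (latticeMomentum L k) := by
  rcases Nat.eq_zero_or_pos n with rfl | hn
  · rw [klTwoLegPieceFn_zero, klTwoLegPieceG_zero, eval_fsub, Pi.sub_apply, klTwoLegPolyFn_eval_latticeMomentum,
      klFrameProjFn_eval_latticeMomentum]
  · obtain ⟨m, rfl⟩ := Nat.exists_eq_succ_of_ne_zero (Nat.pos_iff_ne_zero.mp hn)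
    rw [klTwoLegPieceFn_succ, klTwoLegPieceG_succ, eval_fsub, Pi.sub_apply, klTwoLegPolyFn_eval_latticeMomentum,
      klTwoLegPolyFn_eval_latticeMomentum]

/-- The partial sums of the pieces agree at lattice momenta: `Σ_{i≤N} ℓ_i^{Fn}(K.eval)(p_k) = Σ_{i≤N} ℓ_i^G(K)(p_k)`. -/
theorem sum_klTwoLegPieceFn_eval_latticeMomentum (β U μ : ℝ) (K : TrigPolyC4v) (N : ℕ) (k : TorusSite 2 L) :
    (∑ n ∈ range (N + 1), klTwoLegPieceFn L M β U μ K.eval n) (latticeMomentum L k) =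
      ∑ n ∈ range (N + 1), (klTwoLegPieceG L M β U μ K n).eval (latticeMomentum L k) := by
  rw [Finset.sum_apply]
  exact Finset.sum_congr rfl fun n _ => klTwoLegPieceFn_eval_latticeMomentum L M β U μ K n k

/-- **Child 2's counter-image agrees at lattice momenta**: `(P^{Fn}(K.eval) − D_N^{Fn}(K.eval))(p_k) = (P^G K ⊖ D_N^G K)(p_k)` — the model
reads the same next frame whether child 2 iterates with function pieces or with today's interpolants. -/
theorem counterImageFn_eval_latticeMomentum (β U μ : ℝ) (K : TrigPolyC4v) (N : ℕ) (k : TorusSite 2 L) :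
    (klFrameProjFn μ K.eval - klTwoLegPolyFn L M β U μ K.eval N) (latticeMomentum L k) =
      (fsub (klFrameProjG L μ K) (klTwoLegPolyG L M β U μ K N)).eval (latticeMomentum L k) := by
  rw [Pi.sub_apply, eval_fsub, klFrameProjFn_eval_latticeMomentum, klTwoLegPolyFn_eval_latticeMomentum]

end Views

end Summit.HubbardSuperconductivity.HubbardSuperconductivity.Theorems.KLRegimeSplit

end
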